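import Literature.NumberTheory.DiophantineGeometry.AbelianVarietyOrdinaryReduction
import Literature.NumberTheory.EllipticCurves.TateModuleReductionKernelProofs
import Literature.LinearAlgebra.QuadraticForm.SimilitudeOnIsotropicSubspace
import Literature.AlgebraicGeometry.Motives.AbelianVarietyTorsionPointsCountProofs
import Literature.NumberTheory.GaloisRepresentations.LocalKroneckerWeberInertiaProofs
import HarnessLib

/-!
# The ordinary filtration of `V_p B` from a reduction datum and the Weil pairing (assembly)

`Proofs` file (theorems only, no definitions, no named facts), sibling of
`AbelianVarietyOrdinaryReduction`, supporting the named fact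
`Literature.NumberTheory.DiophantineGeometry.ordinaryReduction_tateModule_filtration`
(Greenberg 1991, §2; Shatz 1986, §6–§7): for an abelian variety `B` over a number field `K` with
good ordinary reduction at `v ∣ p`, `V_p B` has a `g`-dimensional `Γ_{K_v}`-stable subspace `W` on
which inertia acts through `χ_p` and modulo which inertia acts trivially.

This file proves the **Galois-theoretic assembly** of that statement from its three inputs, each
entering as an explicit hypothesis on the data `(B, v, p)` of the fact — so that what remains of
the fact is exactly the construction of these inputs:

1. a **reduction datum** at `v` (Serre–Tate 1968, §1; Greenberg 1991, §2: "a surjective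
   homomorphism of Tate modules `T_p(E) → T_p(Ē)` regarded as `G_{ℚ_p}`-modules"): an additive
   map `red : B(K̄) → Ā` to a `Γ_{K_v}`-module `Ā` (the `κ̄(v)`-points of the reduction), equivariant
   along `res : Γ_{K_v} → Γ_K` (`absGaloisRestrict`), with the inertia group `I_{K_v}`
   (`absInertia`) acting trivially on `Ā`, mapping `B[pⁿ]` onto `Ā[pⁿ]`, and with
   `#Ā[pⁿ] = p^{gn}`, `g = dim B` (ordinarity: `#Ā[p] = p^g` and `p`-divisibility, cf.
   `TateModule.card_torsionBy_pow_of_divisible`);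
2. the **Weil pairing** of a polarisation on `V_p B`: a non-degenerate bilinear form `e` with
   `e(gx, gy) = χ_p(g) e(x, y)` for `g ∈ Γ_K` (the content of the tree's named fact
   `weilPairing_rationalTateModule`, Milne §16);
3. **isotropy of the kernel of reduction** `W = ker (V_p red)` for `e` (the connected part of
   `𝒜[pⁿ]` is self-orthogonal in the ordinary case: Cartier duality, Shatz §6) — automatic when
   `g = 1`, `e` being alternating (`exists_ordinaryFiltration_of_reduction_of_isAlt`).

Given these, `exists_ordinaryFiltration_of_reduction` produces `W` with the four clauses of the
fact verbatim: `dim W = dim B` (`#B[pⁿ] = p^{2gn}` is the tree's theorem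
`natCard_torsionPoints_of_isAlgClosed_holds`, and `rank ker = 2g - g`,
`RationalTateModule.finrank_ker_baseChange_map`); `W` is `res(Γ_{K_v})`-stable; inertia acts
trivially on `V_p B / W` (`RationalTateModule.baseChange_tateRepresentation_sub_mem_ker`); and
inertia acts on `W` by `χ_p(τ)` (`apply_eq_smul_of_forall_sub_mem_of_isotropic` with multiplier
`χ_p(res τ) = χ_p(τ)`, `cyclotomicCharacter_absGaloisRestrict`).

## References

* [Greenberg1991] R. Greenberg, *Iwasawa theory for motives*, LMS LNS 153 (1991), §2, p. 214.
* [SerreTate1968GoodReduction] J.-P. Serre, J. Tate, Ann. of Math. 88 (1968), §1.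
* [Shatz1986GroupSchemes] S. S. Shatz, in *Arithmetic Geometry* (1986), §6–§7.
-/

noncomputable section

open scoped AddSubgroup TensorProduct NumberField
open Field IsDedekindDomain
open Literature.NumberTheory.GaloisRepresentations Literature.NumberTheory.EllipticCurves
open Literature.AlgebraicGeometry.Motives (AbelianVariety)

namespace Literature.NumberTheory.DiophantineGeometry

variable {K : Type} [Field K] [NumberField K]

/-- `#B[pⁿ](K̄) = p^{2gn}` for an abelian variety `B` of dimension `g` over a number field: the
tree's theorem `natCard_torsionPoints_of_isAlgClosed_holds` (Mumford §6, Application 3) on the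
geometric points `B.geomPoints`, in the counting normal form of `TateModuleRank`.
[cite: MumfordAV1970, §6 Application 3 (Proposition p. 64)] -/
theorem natCard_geomTorsion_pow (B : AbelianVariety K) (p : ℕ) [Fact p.Prime] (n : ℕ) :
    Nat.card ((B.geomPoints)[(p ^ n : ℕ)]) = p ^ (2 * B.dim * n) := by
  have hp : (((p ^ n : ℕ) : ℤ) : K) ≠ 0 := by
    exact_mod_cast pow_ne_zero n (Fact.out : p.Prime).ne_zero
  have h := B.natCard_geomTorsion
    (AbelianVariety.natCard_torsionPoints_of_isAlgClosed_holds B (AlgebraicClosure K))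
    ((p ^ n : ℕ) : ℤ) hp
  rw [Int.natAbs_natCast, ← pow_mul, mul_comm n] at h
  exact h

section Assembly

variable (B : AbelianVariety K) (v : HeightOneSpectrum (𝓞 K)) (p : ℕ) [Fact p.Prime]
  {Ā : Type} [AddCommGroup Ā]
  [DistribMulAction (absoluteGaloisGroup (v.adicCompletion K)) Ā]

/-- `T_p red (res τ • x) = τ • T_p red x` for a reduction datum equivariant along
`res : Γ_{K_v} → Γ_K` (componentwise). [folklore] -/
theorem map_red_smul (red : B.geomPoints →+ Ā)
    (hred : ∀ (τ : absoluteGaloisGroup (v.adicCompletion K)) (P : B.geomPoints),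
      red (absGaloisRestrict K (v.adicCompletion K) τ • P) = τ • red P)
    (τ : absoluteGaloisGroup (v.adicCompletion K)) (x : B.tateModule p) :
    TateModule.map p red (absGaloisRestrict K (v.adicCompletion K) τ • x) =
      τ • TateModule.map p red x :=
  TateModule.ext fun n ↦ by
    rw [TateModule.proj_map, TateModule.proj_smul_of_distribMulAction, hred,
      TateModule.proj_smul_of_distribMulAction, TateModule.proj_map]

/-- `V_p red (ρ(res τ) x) = τ • V_p red x` on `V_p B = ℚ_p ⊗ T_p B` (base change of
`map_red_smul`). [folklore] -/
theorem baseChange_map_red_smul (red : B.geomPoints →+ Ā)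
    (hred : ∀ (τ : absoluteGaloisGroup (v.adicCompletion K)) (P : B.geomPoints),
      red (absGaloisRestrict K (v.adicCompletion K) τ • P) = τ • red P)
    (τ : absoluteGaloisGroup (v.adicCompletion K)) (x : ℚ_[p] ⊗[ℤ_[p]] B.tateModule p) :
    (TateModule.map p red).baseChange ℚ_[p]
        ((tateRepresentation (absoluteGaloisGroup K) B.geomPoints p
          (absGaloisRestrict K (v.adicCompletion K) τ)).baseChange ℚ_[p] x) =
      (tateRepresentation (absoluteGaloisGroup (v.adicCompletion K)) Ā p τ).baseChange ℚ_[p]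
        ((TateModule.map p red).baseChange ℚ_[p] x) := by
  induction x using TensorProduct.induction_on with
  | zero => simp only [map_zero]
  | tmul c y =>
    rw [LinearMap.baseChange_tmul, LinearMap.baseChange_tmul, LinearMap.baseChange_tmul,
      LinearMap.baseChange_tmul, tateRepresentation_apply_apply, tateRepresentation_apply_apply,
      map_red_smul B v p red hred]
  | add x y hx hy => simp only [map_add, hx, hy]

/-- **The ordinary filtration of `V_p B`, assembled.**  Let `B/K` be an abelian variety over a
number field, `v` a finite place, `p` a prime.  Suppose given (1) a reduction datum
`red : B(K̄) → Ā`, `Γ_{K_v}`-equivariant along `res`, inertia trivial on `Ā`, onto on `pⁿ`-torsion,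
`#Ā[pⁿ] = p^{(dim B) n}`; (2) a non-degenerate bilinear form `e` on `V_p B` with
`e(gx, gy) = χ_p(g) e(x, y)` (Weil pairing); (3) `ker (V_p red)` isotropic for `e`.  Then
`W = ker (V_p red)` satisfies the four clauses of
`ordinaryReduction_tateModule_filtration`: `dim W = dim B`, `W` is `res(Γ_{K_v})`-stable,
inertia acts on `W` by `χ_p(τ)`, and trivially on `V_p B / W`.  (Greenberg 1991, §2, p. 214,
for `E/ℚ`; the general case as in Shatz 1986, §6–§7.)
[cite: Greenberg1991, §2 (p. 214)] -/
theorem exists_ordinaryFiltration_of_reduction (red : B.geomPoints →+ Ā)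
    (hred : ∀ (τ : absoluteGaloisGroup (v.adicCompletion K)) (P : B.geomPoints),
      red (absGaloisRestrict K (v.adicCompletion K) τ • P) = τ • red P)
    (hI : ∀ τ ∈ absInertia (v.adicCompletion K), ∀ y : Ā, τ • y = y)
    (hcount : ∀ n, Nat.card (Ā[(p ^ n : ℕ)]) = p ^ (B.dim * n))
    (hsurj : ∀ n, ∀ y ∈ Ā[(p ^ n : ℕ)], ∃ x ∈ (B.geomPoints)[(p ^ n : ℕ)], red x = y)
    (e : LinearMap.BilinForm ℚ_[p] (B.rationalTateModule p)) (he : e.Nondegenerate)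
    (heq : ∀ (g : absoluteGaloisGroup K) (x y : B.rationalTateModule p),
      e (B.rationalTateRep p g x) (B.rationalTateRep p g y) =
        (((GaloisRep.cyclotomicCharacter K p g : ℤ_[p]ˣ) : ℤ_[p]) : ℚ_[p]) * e x y)
    (hiso : ∀ x y : B.rationalTateModule p,
      (TateModule.map p red).baseChange ℚ_[p] x = 0 →
        (TateModule.map p red).baseChange ℚ_[p] y = 0 → e x y = 0) :
    ∃ W : Submodule ℚ_[p] (B.rationalTateModule p),
      Module.finrank ℚ_[p] W = B.dim ∧
      (∀ (τ : absoluteGaloisGroup (v.adicCompletion K)), ∀ w ∈ W,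
          B.rationalTateRep p (absGaloisRestrict K (v.adicCompletion K) τ) w ∈ W) ∧
      (∀ τ ∈ absInertia (v.adicCompletion K), ∀ w ∈ W,
          B.rationalTateRep p (absGaloisRestrict K (v.adicCompletion K) τ) w =
            (((GaloisRep.cyclotomicCharacter (v.adicCompletion K) p τ : ℤ_[p]ˣ) : ℤ_[p]) :
              ℚ_[p]) • w) ∧
      (∀ τ ∈ absInertia (v.adicCompletion K), ∀ x : B.rationalTateModule p,
          B.rationalTateRep p (absGaloisRestrict K (v.adicCompletion K) τ) x - x ∈ W) := by
  haveI : NeZero (p : K) := ⟨Nat.cast_ne_zero.mpr (Fact.out : p.Prime).ne_zero⟩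
  -- `W = F¹ = ker (V_p red)`
  let W : Submodule ℚ_[p] (B.rationalTateModule p) :=
    LinearMap.ker ((TateModule.map p red).baseChange ℚ_[p])
  have hW : ∀ x : B.rationalTateModule p,
      x ∈ W ↔ (TateModule.map p red).baseChange ℚ_[p] x = 0 := fun x ↦ LinearMap.mem_ker
  -- inertia moves everything into `W` (clause 4)
  have h4 : ∀ τ ∈ absInertia (v.adicCompletion K), ∀ x : B.rationalTateModule p,
      B.rationalTateRep p (absGaloisRestrict K (v.adicCompletion K) τ) x - x ∈ W :=
    fun τ hτ x ↦ RationalTateModule.baseChange_tateRepresentation_sub_mem_ker red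
      (absGaloisRestrict K (v.adicCompletion K) τ) (fun P ↦ by rw [hred, hI τ hτ]) x
  refine ⟨W, ?_, ?_, ?_, h4⟩
  · -- clause 1: `dim W = 2g - g`
    have h := RationalTateModule.finrank_ker_baseChange_map (f := red)
      (natCard_geomTorsion_pow B p) hcount hsurj
    rw [two_mul, Nat.add_sub_cancel] at h
    exact h
  · -- clause 2: stability under `res (Γ_{K_v})`
    intro τ w hw
    rw [hW] at hw ⊢
    change (TateModule.map p red).baseChange ℚ_[p]
      ((tateRepresentation (absoluteGaloisGroup K) B.geomPoints p
        (absGaloisRestrict K (v.adicCompletion K) τ)).baseChange ℚ_[p] w) = 0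
    rw [baseChange_map_red_smul B v p red hred, hw, map_zero]
  · -- clause 3: inertia acts on `W` by `χ_p(res τ) = χ_p(τ)`
    intro τ hτ w hw
    rw [← cyclotomicCharacter_absGaloisRestrict K (v.adicCompletion K) p τ]
    exact Literature.LinearAlgebra.QuadraticForm.apply_eq_smul_of_forall_sub_mem_of_isotropic e he
      (B.rationalTateRep p (absGaloisRestrict K (v.adicCompletion K) τ)) _
      (heq (absGaloisRestrict K (v.adicCompletion K) τ)) W
      (fun x hx y hy ↦ hiso x y ((hW x).mp hx) ((hW y).mp hy)) (h4 τ hτ) w hw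

/-- **The case `dim B = 1` needs no isotropy hypothesis**: for an alternating `e` (the Weil
pairing is alternating, Milne §16 Lemma 16.2 (e)) the line `W = ker (V_p red)` is isotropic, and
the determinant step of Greenberg 1991, §2, p. 214 ("by `𝒩¹` on `gr¹(V_p)` since the determinant
of the Galois action on `T_p(E)` is `𝒩`") applies
(`apply_eq_smul_of_forall_sub_mem_of_isAlt_of_finrank_eq_one`).
[cite: Greenberg1991, §2 (p. 214)] -/
theorem exists_ordinaryFiltration_of_reduction_of_isAlt (hdim : B.dim = 1)
    (red : B.geomPoints →+ Ā)
    (hred : ∀ (τ : absoluteGaloisGroup (v.adicCompletion K)) (P : B.geomPoints),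
      red (absGaloisRestrict K (v.adicCompletion K) τ • P) = τ • red P)
    (hI : ∀ τ ∈ absInertia (v.adicCompletion K), ∀ y : Ā, τ • y = y)
    (hcount : ∀ n, Nat.card (Ā[(p ^ n : ℕ)]) = p ^ (B.dim * n))
    (hsurj : ∀ n, ∀ y ∈ Ā[(p ^ n : ℕ)], ∃ x ∈ (B.geomPoints)[(p ^ n : ℕ)], red x = y)
    (e : LinearMap.BilinForm ℚ_[p] (B.rationalTateModule p)) (he : e.Nondegenerate)
    (halt : e.IsAlt)
    (heq : ∀ (g : absoluteGaloisGroup K) (x y : B.rationalTateModule p),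
      e (B.rationalTateRep p g x) (B.rationalTateRep p g y) =
        (((GaloisRep.cyclotomicCharacter K p g : ℤ_[p]ˣ) : ℤ_[p]) : ℚ_[p]) * e x y) :
    ∃ W : Submodule ℚ_[p] (B.rationalTateModule p),
      Module.finrank ℚ_[p] W = B.dim ∧
      (∀ (τ : absoluteGaloisGroup (v.adicCompletion K)), ∀ w ∈ W,
          B.rationalTateRep p (absGaloisRestrict K (v.adicCompletion K) τ) w ∈ W) ∧
      (∀ τ ∈ absInertia (v.adicCompletion K), ∀ w ∈ W,
          B.rationalTateRep p (absGaloisRestrict K (v.adicCompletion K) τ) w =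
            (((GaloisRep.cyclotomicCharacter (v.adicCompletion K) p τ : ℤ_[p]ˣ) : ℤ_[p]) :
              ℚ_[p]) • w) ∧
      (∀ τ ∈ absInertia (v.adicCompletion K), ∀ x : B.rationalTateModule p,
          B.rationalTateRep p (absGaloisRestrict K (v.adicCompletion K) τ) x - x ∈ W) := by
  -- the kernel of reduction is a line, hence isotropic for the alternating `e`
  let W : Submodule ℚ_[p] (B.rationalTateModule p) :=
    LinearMap.ker ((TateModule.map p red).baseChange ℚ_[p])
  have hW1 : Module.finrank ℚ_[p] W = 1 := by
    have h := RationalTateModule.finrank_ker_baseChange_map (f := red)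
      (natCard_geomTorsion_pow B p) hcount hsurj
    rw [two_mul, Nat.add_sub_cancel, hdim] at h
    exact h
  have hiso := Literature.LinearAlgebra.QuadraticForm.forall_apply_eq_zero_of_isAlt_of_finrank_eq_one
    e halt W hW1
  exact exists_ordinaryFiltration_of_reduction B v p red hred hI hcount hsurj e he heq
    fun x y hx hy ↦ hiso x (LinearMap.mem_ker.mpr hx) y (LinearMap.mem_ker.mpr hy)

end Assembly

/-- **What remains of the named fact.**  `ordinaryReduction_tateModule_filtration` follows as soon
as every abelian variety `B` with good ordinary reduction at `v ∣ p` is given the three inputs of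
`exists_ordinaryFiltration_of_reduction`: a reduction datum at `v` (Serre–Tate 1968, §1), a Weil
pairing on `V_p B` (Milne 1986, §16; the tree's fact `weilPairing_rationalTateModule`) and the
isotropy of the kernel of reduction (Shatz 1986, §6).  A reduction theorem (the hypothesis is the
geometric input, not the conclusion); it checks that the assembly has the fact's exact shape.
[cite: Greenberg1991, §2 (p. 214)] -/
theorem ordinaryReduction_tateModule_filtration_of_reductionData
    (hdata : ∀ {K : Type} [Field K] [NumberField K] (B : AbelianVariety K)
      (v : HeightOneSpectrum (𝓞 K)) (p : ℕ) [Fact p.Prime],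
      ((p : ℕ) : 𝓞 K) ∈ v.asIdeal → B.HasGoodOrdinaryReductionAt v →
      ∃ (Ā : Type) (_ : AddCommGroup Ā)
        (_ : DistribMulAction (absoluteGaloisGroup (v.adicCompletion K)) Ā)
        (red : B.geomPoints →+ Ā) (e : LinearMap.BilinForm ℚ_[p] (B.rationalTateModule p)),
        (∀ (τ : absoluteGaloisGroup (v.adicCompletion K)) (P : B.geomPoints),
            red (absGaloisRestrict K (v.adicCompletion K) τ • P) = τ • red P) ∧
        (∀ τ ∈ absInertia (v.adicCompletion K), ∀ y : Ā, τ • y = y) ∧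
        (∀ n, Nat.card (Ā[(p ^ n : ℕ)]) = p ^ (B.dim * n)) ∧
        (∀ n, ∀ y ∈ Ā[(p ^ n : ℕ)], ∃ x ∈ (B.geomPoints)[(p ^ n : ℕ)], red x = y) ∧
        e.Nondegenerate ∧
        (∀ (g : absoluteGaloisGroup K) (x y : B.rationalTateModule p),
            e (B.rationalTateRep p g x) (B.rationalTateRep p g y) =
              (((GaloisRep.cyclotomicCharacter K p g : ℤ_[p]ˣ) : ℤ_[p]) : ℚ_[p]) * e x y) ∧
        (∀ x y : B.rationalTateModule p,
            (TateModule.map p red).baseChange ℚ_[p] x = 0 →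
              (TateModule.map p red).baseChange ℚ_[p] y = 0 → e x y = 0)) :
    ordinaryReduction_tateModule_filtration := by
  intro K _ _ B v p _ hpv hord
  obtain ⟨Ā, _, _, red, e, hred, hI, hcount, hsurj, he, heq, hiso⟩ := hdata B v p hpv hord
  exact exists_ordinaryFiltration_of_reduction B v p red hred hI hcount hsurj e he heq hiso

end Literature.NumberTheory.DiophantineGeometry
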